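import Summits.QuantumFields.BalabanUV.Beta.GAN24.LayerTransportLedger

/-!
# `BalabanUV.Beta.GAN24.LayerTransportBiLoc` — binder row G-an2-4 / (CONV-C), W-slot CT-W, route «WC-TL» ∕ «QR-LL», row **(LT-Δ) «LAYER TRANSPORT»**, part (LT-3) END IN THE
# CONSUMER's CURRENCY: the pure cell's ledger (`LayerTransportLedger`) repackaged as the slot-weighted `BiLoc` statement that the OWNER gan24-p1's END
# `WardRemainderRows.wLocStencil_unitS_of_unrolled` (p320499 ✓) consumes through `hσ` — `BiLoc (L^{12} • push₃ l r w S ν U) U U (C_E(U)·L⁻¹ + C_G(U)·(√L)⁻¹) (κ∕4)` at `d = 3`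

NOT IN PRINT; OUR BOOKKEEPING ([folklore] the ff entries by `LayerTransportLedger.abs_cubic_push₃_layer_ledger_three_half` ∕ `…_ledger_le`, the other fibre blocks are zero by
`Push3.isFF_push₃`; G-an2-4 formalisation swarm, leaf prover `b2b-balaban-gan24-formalise-leaf-01`, gen 64).  HONEST FRAMING (cell contract, verbatim): «discharging `BetaPertH`
makes Bałaban's UV stability UNCONDITIONAL — a real constructive-QFT result; it is NOT the continuum limit and NOT the Clay problem.»  HONEST DEPENDENCY (verbatim): «continuum YM
on T⁴ ⇐ BetaPertH ∧ nine spine estimates (0/9 proved); BetaPertH ⇐ (D1) ∧ (D4) ∧ CAP+tail; G-an2-4 gates asym, D1 and NE2/3/4.»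

## What (GENERIC legs ∕ letters; hypotheses = `LayerTransportLedger`'s, verbatim)
**`biLoc_cubic_push₃_layer_ledger`** (generic `d`, free `S₂`): `BiLoc ((L^{3(d+1)}) • push₃ l r w S ν U) U U (K_E·L^d(L^4)⁻¹·e^{−η‖y−U‖₁} + (d+1)³·K_G·CT·(S₂·L^{2d})·e^{−(κ∕2)‖Y−U‖₁}) (κ∕4)` —
centre = the output slot site `U` on both kernel indices, rate `κ∕4`, constant = a fixed function of the slot (the WEIGHT `ω κ U` of the OWNER's `wLocStencil` class up to
the `L`-powers); **`biLoc_cubic_push₃_layer_ledger_three_half`** (`d = 3`, `S₂ = (L^6·√L)⁻¹`): constant `K_E·L⁻¹·e^{−η‖y−U‖₁} + 4³·K_G·CT·(√L)⁻¹·e^{−(κ∕2)‖Y−U‖₁}`; `biLoc_mono`;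
**`biLoc_cubic_push₃_layer_three_weight`** (`Y := y`: ONE weight, ONE ratio — `((K_E + 4³·K_G·CT)·(√L)⁻¹·e^{−η‖y−U‖₁})`) — with
`L = Lc^{n−1−m}` this is the `C·θ^{n−1−m}·ω κ u` shape of `hσ` at `θ = Lc^{−1∕2}` (the OWNER's R-gan24p1-g26-3: «any NET exponent < 0 closes (DUH)»), for legs GIVEN BY
ENVELOPES and modulo the letter-side binders; the identification «(REP)'s transport over `n−1−m` levels = ONE `push₃` through the composite legs» is `Push3Nest.transport_push₃`
(this lineage, g43–44) and is NOT re-proved here.  [folklore]; 0 cited facts, 0 `def`, 0 `def … : Prop`, 0 sorry.  The literal's legs are DRESSED (K-LL-4, R-gan24p1-g26-2);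
NOTHING of (Q-R)∕(LT)∕(Q-L)∕(C)∕«T2Shape»∕«T2Drift»∕(hW, hWall) discharged; NEVER «G-an2-4 closed» as (CONV-C); NOT D1, NOT `BetaPertH`, NOT continuum, NOT Clay.  2026-08-22.
-/

noncomputable section

open Finset
open scoped BigOperators
open Literature.MathematicalPhysics.QuantumFieldTheory
open Literature.MathematicalPhysics.QuantumFieldTheory.Balaban1983to89
open Literature.MathematicalPhysics.QuantumFieldTheory.Balaban1983to89.Beta
open B12Sec2to5 (l1 l1_nonneg)
open B6BondElimination (unitVec)
open ExpKernelCalculus (MKer Site BiLoc Zl Zl_nonneg Zl_pos)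
open OneStepResolventKernel (Fib)
open LatticeForm (quo)
open AffineAveraging (box toSite)
open Summit.QuantumFields.BalabanUV.Beta.GAN24.Push4 (IsFF)
open Summit.QuantumFields.BalabanUV.Beta.GAN24.Push3 (push₃ isFF_push₃)
open Summit.QuantumFields.BalabanUV.Beta.GAN24.LayerTransportLedger (abs_cubic_push₃_layer_ledger_le)
open Summit.QuantumFields.BalabanUV.Beta.GAN24.LayerFrozenCount (inv_pow_le_inv_pow_sqrt)

namespace Summit.QuantumFields.BalabanUV.Beta.GAN24.LayerTransportBiLoc

variable {d : ℕ}

/-- [folklore] A ff-supported kernel whose ff entries are bounded by `C·e^{−δ(‖x−p‖₁+‖z−q‖₁)}` with `0 ≤ C` is `BiLoc … p q C δ`. -/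
theorem biLoc_of_isFF {K : MKer (d + 1) (Fib d)} (hK : IsFF K) {p q : Fin (d + 1) → ℤ} {C δ : ℝ} (hC : 0 ≤ C)
    (hff : ∀ x z α β, |K x z (Sum.inl α) (Sum.inl β)| ≤ C * Real.exp (-δ * (l1 (x - p) + l1 (z - q)))) : BiLoc K p q C δ := by
  intro x z a b
  rcases a with α | μ
  · rcases b with β | μ'
    · exact hff x z α β
    · rw [hK.2 x z _ μ', abs_zero]; positivity
  · rw [hK.1 x z μ b, abs_zero]; positivity

section End

variable {l r w : Fin (d + 1) → (Fin (d + 1) → ℤ) → Fin (d + 1) → (Fin (d + 1) → ℤ) → ℝ}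
  {S : Fin (d + 1) → (Fin (d + 1) → ℤ) → MKer (d + 1) (Fib d)} {ω : (Fin (d + 1) → ℤ) → ℝ}
  {Z : Fin (d + 1) → Fin (d + 1) → Fin (d + 1) → (Fin (d + 1) → ℤ) → (Fin (d + 1) → ℤ) → ℝ} {T : Finset (Fin (d + 1) → ℤ)}
  {L : ℕ} {A A' A'' S₂ Cs κ m δ B δZ ρ CT : ℝ} {Y : Fin (d + 1) → ℤ}

/-- NOT IN PRINT; OUR BOOKKEEPING (`LayerTransportLedger.abs_cubic_push₃_layer_ledger_le` ⨾ `biLoc_of_isFF`).  **(LT-3) THE PURE CELL IN `BiLoc` CURRENCY, GENERIC `d`, FREE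
SCALE `S₂ ≥ (L^{d+4})⁻¹`**: under the hypotheses of the ledger (legs by (N1)∕(N1′) envelopes + unit second differences `A″·S₂`; letter family with the weighted slot profile under
leaf-03's face weight of the block of label `y`; label-decomposed charge profiles with (M0_{y′}), (Π_{y′})), the cubic-weighted pushed letter AT THE OUTPUT SLOT `(ν, U)` is
bi-localised at `U` with rate `κ∕4` and the slot-dependent constant
`K_E·L^d(L^4)⁻¹·e^{−η‖y−U‖₁} + (d+1)³·K_G·CT·(S₂·L^{2d})·e^{−(κ∕2)‖Y−U‖₁}` — the `c·ω κ u` shape of `WardRemainderRows.wLocStencil_good`. -/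
theorem biLoc_cubic_push₃_layer_ledger (hL : 1 ≤ L) (hκ : 0 < κ) (hm : κ < m) (hδ : 0 < δ) (hA : 0 ≤ A) (hA' : 0 ≤ A') (hA'' : 0 ≤ A'') (hCs : 0 ≤ Cs)
    (hB : 0 ≤ B) (hκδZ : 4 * κ < δZ) (hS₂ : (((L : ℝ)) ^ (d + 4))⁻¹ ≤ S₂)
    (hl : ∀ α x' k x, |l α x' k x| ≤ A * (((L : ℝ)) ^ (d + 2))⁻¹ * Real.exp (-κ * l1 (quo L x - x')))
    (hl' : ∀ α x' k x i, |l α x' k (x + Pi.single i 1) - l α x' k x| ≤ A' * (((L : ℝ)) ^ (d + 3))⁻¹ * Real.exp (-κ * l1 (quo L x - x')))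
    (hl'' : ∀ α x' k x i j, |(l α x' k (x + Pi.single i 1 + Pi.single j 1) - l α x' k (x + Pi.single j 1)) - (l α x' k (x + Pi.single i 1) - l α x' k x)|
      ≤ A'' * S₂ * Real.exp (-κ * l1 (quo L x - x')))
    (hr : ∀ β z' k z, |r β z' k z| ≤ A * (((L : ℝ)) ^ (d + 2))⁻¹ * Real.exp (-κ * l1 (quo L z - z')))
    (hr' : ∀ β z' k z i, |r β z' k (z + Pi.single i 1) - r β z' k z| ≤ A' * (((L : ℝ)) ^ (d + 3))⁻¹ * Real.exp (-κ * l1 (quo L z - z')))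
    (hr'' : ∀ β z' k z i j, |(r β z' k (z + Pi.single i 1 + Pi.single j 1) - r β z' k (z + Pi.single j 1)) - (r β z' k (z + Pi.single i 1) - r β z' k z)|
      ≤ A'' * S₂ * Real.exp (-κ * l1 (quo L z - z')))
    (hw : ∀ ν U k u, |w ν U k u| ≤ A * (((L : ℝ)) ^ (d + 2))⁻¹ * Real.exp (-κ * l1 (quo L u - U)))
    (hw' : ∀ ν U k u i, |w ν U k (u + Pi.single i 1) - w ν U k u| ≤ A' * (((L : ℝ)) ^ (d + 3))⁻¹ * Real.exp (-κ * l1 (quo L u - U)))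
    (hw'' : ∀ ν U k u i j, |(w ν U k (u + Pi.single i 1 + Pi.single j 1) - w ν U k (u + Pi.single j 1)) - (w ν U k (u + Pi.single i 1) - w ν U k u)|
      ≤ A'' * S₂ * Real.exp (-κ * l1 (quo L u - U)))
    (hS : ∀ k u x z a b, |S k u x z a b| ≤ Cs * ω u * Real.exp (-m * (l1 (x - u) + l1 (z - u))))
    (y : Fin (d + 1) → ℤ)
    (hω : ∀ u, 0 ≤ ω u ∧ ω u ≤ ∑ μ : Fin (d + 1),
      (∑ v ∈ ((box (d + 1) L).filter (fun v => v μ = L - 1)).image (fun v => (L : ℤ) • y + toSite v), Real.exp (-δ * l1 (v - u))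
        + ∑ v ∈ ((box (d + 1) L).filter (fun v => v μ = 0)).image (fun v => (L : ℤ) • y + toSite v - unitVec μ),
            Real.exp (-δ * l1 (v - u))))
    (hQ : ∀ k κ₁ κ₂ u, ∑' x, ∑' z, S k u x z (Sum.inl κ₁) (Sum.inl κ₂) = ∑ y' ∈ T, Z k κ₁ κ₂ y' u)
    (hZ : ∀ k κ₁ κ₂, ∀ y' ∈ T, ∀ e, |Z k κ₁ κ₂ y' e| ≤ B * Real.exp (-δZ * l1 (e - y')))
    (hM0 : ∀ k κ₁ κ₂, ∀ y' ∈ T, ∑' e, Z k κ₁ κ₂ y' e = 0)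
    (hP1 : ∀ k κ₁ κ₂, ∀ y' ∈ T, ∀ i : Fin (d + 1), ∑' e, (((e - y') i : ℤ) : ℝ) * Z k κ₁ κ₂ y' e = 0)
    (hT : ∀ y' ∈ T, l1 (quo L y' - Y) ≤ ρ) (hTcard : (T.card : ℝ) ≤ CT * (L : ℝ) ^ (d + 1))
    (ν : Fin (d + 1)) (U : Fin (d + 1) → ℤ) :
    BiLoc (((L : ℝ) ^ (3 * (d + 1))) • push₃ l r w S ν U) U U
      (((((d : ℝ) + 1) ^ 3 * A ^ 2 * A' * Cs * (2 / (m - κ) * Zl (d + 1) ((m - κ) / 2)) * (Zl (d + 1) (m - κ) + Zl (d + 1) m))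
            * ((2 * ((d : ℝ) + 1)) ^ 2 * Zl (d + 1) (δ / 2) * Real.exp (min (κ / 2) (δ / 2))))
          * ((L : ℝ) ^ d * ((L : ℝ) ^ 4)⁻¹) * Real.exp (-(min (κ / 2) (δ / 2)) * l1 (y - U))
        + ((d : ℝ) + 1) ^ 3 *
          (((((A'' * A * A + 2 * A' * A' * A + A * A'' * A) * Real.exp (2 * κ) + 2 * ((A' * A + A * A') * Real.exp κ) * A' + A * A * A'')
              * Real.exp (2 * (2 * κ))) * B * (8 / (δZ - 2 * (2 * κ)) ^ 2 * Zl (d + 1) ((δZ - 2 * (2 * κ)) / 4)) * Real.exp ((κ / 2) * ρ) * CT)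
            * (S₂ * (L : ℝ) ^ (2 * d)) * Real.exp (-(κ / 2) * l1 (Y - U))))
      (κ / 4) := by
  have hL0 : (0 : ℝ) < (L : ℝ) := by exact_mod_cast hL
  have hmk : 0 < m - κ := sub_pos.2 hm
  have hc : 0 < δZ - 2 * (2 * κ) := by linarith
  have hZ1 : 0 ≤ Zl (d + 1) ((m - κ) / 2) := Zl_nonneg (half_pos hmk)
  have hZ2 : 0 ≤ Zl (d + 1) (m - κ) := Zl_nonneg hmk
  have hZ3 : 0 ≤ Zl (d + 1) m := Zl_nonneg (hκ.trans hm)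
  have hZ4 : 0 ≤ Zl (d + 1) (δ / 2) := Zl_nonneg (half_pos hδ)
  have hZ5 : 0 ≤ Zl (d + 1) ((δZ - 2 * (2 * κ)) / 4) := Zl_nonneg (by positivity)
  have hS₂0 : 0 ≤ S₂ := le_trans (by positivity) hS₂
  have hCT : 0 ≤ CT := by
    have h0 : (0 : ℝ) ≤ (T.card : ℝ) := by positivity
    by_contra hneg
    have h1 : CT * (L : ℝ) ^ (d + 1) < 0 := mul_neg_of_neg_of_pos (not_le.1 hneg) (pow_pos hL0 _)
    linarith [hTcard]
  refine biLoc_of_isFF (isFF_push₃ (l := l) (r := r) (w := w) S ν U |> fun h => ⟨fun x z μ b => by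
      show (L : ℝ) ^ (3 * (d + 1)) * push₃ l r w S ν U x z (Sum.inr μ) b = 0
      rw [h.1 x z μ b, mul_zero], fun x z a ν' => by
      show (L : ℝ) ^ (3 * (d + 1)) * push₃ l r w S ν U x z a (Sum.inr ν') = 0
      rw [h.2 x z a ν', mul_zero]⟩) (by positivity) fun x' z' α β => ?_
  have h := abs_cubic_push₃_layer_ledger_le hL hκ hm hδ hA hA' hA'' hCs hB hκδZ hS₂ hl hl' hl'' hr hr' hr'' hw hw' hw'' hS y hω hQ hZ hM0 hP1 hT hTcard ν U x' z' α β
  show |(L : ℝ) ^ (3 * (d + 1)) * push₃ l r w S ν U x' z' (Sum.inl α) (Sum.inl β)| ≤ _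
  refine h.trans (le_of_eq ?_)
  ring

/-- NOT IN PRINT; OUR BOOKKEEPING.  **(LT-3) AT `d = 3` IN `BiLoc` CURRENCY, HÖLDER SCALE `S₂ = (L^6·√L)⁻¹`**: constant `K_E·L⁻¹·e^{−η‖y−U‖₁} + 4³·K_G·CT·(√L)⁻¹·e^{−(κ∕2)‖Y−U‖₁}` —
read with `L = Lc^{n−1−m}` this is `hσ`'s `C·θ^{n−1−m}·ω κ u` at `θ = Lc^{−1∕2}` (weights `e^{−η‖y−u‖₁}`, `e^{−(κ∕2)‖Y−u‖₁}` — fixed functions of the slot). -/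
theorem biLoc_cubic_push₃_layer_ledger_three_half {l r w : Fin (3 + 1) → (Fin (3 + 1) → ℤ) → Fin (3 + 1) → (Fin (3 + 1) → ℤ) → ℝ}
    {S : Fin (3 + 1) → (Fin (3 + 1) → ℤ) → MKer (3 + 1) (Fib 3)} {ω : (Fin (3 + 1) → ℤ) → ℝ}
    {Z : Fin (3 + 1) → Fin (3 + 1) → Fin (3 + 1) → (Fin (3 + 1) → ℤ) → (Fin (3 + 1) → ℤ) → ℝ} {T : Finset (Fin (3 + 1) → ℤ)}
    {L : ℕ} {A A' A'' Cs κ m δ B δZ ρ CT : ℝ} {Y : Fin (3 + 1) → ℤ}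
    (hL : 1 ≤ L) (hκ : 0 < κ) (hm : κ < m) (hδ : 0 < δ) (hA : 0 ≤ A) (hA' : 0 ≤ A') (hA'' : 0 ≤ A'') (hCs : 0 ≤ Cs)
    (hB : 0 ≤ B) (hκδZ : 4 * κ < δZ)
    (hl : ∀ α x' k x, |l α x' k x| ≤ A * (((L : ℝ)) ^ (3 + 2))⁻¹ * Real.exp (-κ * l1 (quo L x - x')))
    (hl' : ∀ α x' k x i, |l α x' k (x + Pi.single i 1) - l α x' k x| ≤ A' * (((L : ℝ)) ^ (3 + 3))⁻¹ * Real.exp (-κ * l1 (quo L x - x')))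
    (hl'' : ∀ α x' k x i j, |(l α x' k (x + Pi.single i 1 + Pi.single j 1) - l α x' k (x + Pi.single j 1)) - (l α x' k (x + Pi.single i 1) - l α x' k x)|
      ≤ A'' * (((L : ℝ)) ^ (3 + 3) * Real.sqrt (L : ℝ))⁻¹ * Real.exp (-κ * l1 (quo L x - x')))
    (hr : ∀ β z' k z, |r β z' k z| ≤ A * (((L : ℝ)) ^ (3 + 2))⁻¹ * Real.exp (-κ * l1 (quo L z - z')))
    (hr' : ∀ β z' k z i, |r β z' k (z + Pi.single i 1) - r β z' k z| ≤ A' * (((L : ℝ)) ^ (3 + 3))⁻¹ * Real.exp (-κ * l1 (quo L z - z')))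
    (hr'' : ∀ β z' k z i j, |(r β z' k (z + Pi.single i 1 + Pi.single j 1) - r β z' k (z + Pi.single j 1)) - (r β z' k (z + Pi.single i 1) - r β z' k z)|
      ≤ A'' * (((L : ℝ)) ^ (3 + 3) * Real.sqrt (L : ℝ))⁻¹ * Real.exp (-κ * l1 (quo L z - z')))
    (hw : ∀ ν U k u, |w ν U k u| ≤ A * (((L : ℝ)) ^ (3 + 2))⁻¹ * Real.exp (-κ * l1 (quo L u - U)))
    (hw' : ∀ ν U k u i, |w ν U k (u + Pi.single i 1) - w ν U k u| ≤ A' * (((L : ℝ)) ^ (3 + 3))⁻¹ * Real.exp (-κ * l1 (quo L u - U)))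
    (hw'' : ∀ ν U k u i j, |(w ν U k (u + Pi.single i 1 + Pi.single j 1) - w ν U k (u + Pi.single j 1)) - (w ν U k (u + Pi.single i 1) - w ν U k u)|
      ≤ A'' * (((L : ℝ)) ^ (3 + 3) * Real.sqrt (L : ℝ))⁻¹ * Real.exp (-κ * l1 (quo L u - U)))
    (hS : ∀ k u x z a b, |S k u x z a b| ≤ Cs * ω u * Real.exp (-m * (l1 (x - u) + l1 (z - u))))
    (y : Fin (3 + 1) → ℤ)
    (hω : ∀ u, 0 ≤ ω u ∧ ω u ≤ ∑ μ : Fin (3 + 1),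
      (∑ v ∈ ((box (3 + 1) L).filter (fun v => v μ = L - 1)).image (fun v => (L : ℤ) • y + toSite v), Real.exp (-δ * l1 (v - u))
        + ∑ v ∈ ((box (3 + 1) L).filter (fun v => v μ = 0)).image (fun v => (L : ℤ) • y + toSite v - unitVec μ),
            Real.exp (-δ * l1 (v - u))))
    (hQ : ∀ k κ₁ κ₂ u, ∑' x, ∑' z, S k u x z (Sum.inl κ₁) (Sum.inl κ₂) = ∑ y' ∈ T, Z k κ₁ κ₂ y' u)
    (hZ : ∀ k κ₁ κ₂, ∀ y' ∈ T, ∀ e, |Z k κ₁ κ₂ y' e| ≤ B * Real.exp (-δZ * l1 (e - y')))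
    (hM0 : ∀ k κ₁ κ₂, ∀ y' ∈ T, ∑' e, Z k κ₁ κ₂ y' e = 0)
    (hP1 : ∀ k κ₁ κ₂, ∀ y' ∈ T, ∀ i : Fin (3 + 1), ∑' e, (((e - y') i : ℤ) : ℝ) * Z k κ₁ κ₂ y' e = 0)
    (hT : ∀ y' ∈ T, l1 (quo L y' - Y) ≤ ρ) (hTcard : (T.card : ℝ) ≤ CT * (L : ℝ) ^ (3 + 1))
    (ν : Fin (3 + 1)) (U : Fin (3 + 1) → ℤ) :
    BiLoc (((L : ℝ) ^ (3 * (3 + 1))) • push₃ l r w S ν U) U U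
      (((((3 : ℝ) + 1) ^ 3 * A ^ 2 * A' * Cs * (2 / (m - κ) * Zl (3 + 1) ((m - κ) / 2)) * (Zl (3 + 1) (m - κ) + Zl (3 + 1) m))
            * ((2 * ((3 : ℝ) + 1)) ^ 2 * Zl (3 + 1) (δ / 2) * Real.exp (min (κ / 2) (δ / 2))))
          * ((L : ℝ))⁻¹ * Real.exp (-(min (κ / 2) (δ / 2)) * l1 (y - U))
        + ((3 : ℝ) + 1) ^ 3 *
          (((((A'' * A * A + 2 * A' * A' * A + A * A'' * A) * Real.exp (2 * κ) + 2 * ((A' * A + A * A') * Real.exp κ) * A' + A * A * A'')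
              * Real.exp (2 * (2 * κ))) * B * (8 / (δZ - 2 * (2 * κ)) ^ 2 * Zl (3 + 1) ((δZ - 2 * (2 * κ)) / 4)) * Real.exp ((κ / 2) * ρ) * CT)
            * (Real.sqrt (L : ℝ))⁻¹ * Real.exp (-(κ / 2) * l1 (Y - U))))
      (κ / 4) := by
  have hL0 : (0 : ℝ) < (L : ℝ) := by exact_mod_cast hL
  have hL1 : (1 : ℝ) ≤ (L : ℝ) := by exact_mod_cast hL
  have hLne : (L : ℝ) ≠ 0 := hL0.ne'
  have h := biLoc_cubic_push₃_layer_ledger (d := 3) (S₂ := (((L : ℝ)) ^ (3 + 3) * Real.sqrt (L : ℝ))⁻¹) hL hκ hm hδ hA hA' hA'' hCs hB hκδZ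
    (inv_pow_le_inv_pow_sqrt (L : ℝ) hL1 3) hl hl' hl'' hr hr' hr'' hw hw' hw'' hS y hω hQ hZ hM0 hP1 hT hTcard ν U
  have e1 : ((L : ℝ)) ^ 3 * (((L : ℝ)) ^ 4)⁻¹ = ((L : ℝ))⁻¹ := by field_simp
  have e2 : (((L : ℝ)) ^ (3 + 3) * Real.sqrt (L : ℝ))⁻¹ * ((L : ℝ)) ^ (2 * 3) = (Real.sqrt (L : ℝ))⁻¹ := by
    rw [mul_inv, mul_assoc, mul_comm ((Real.sqrt (L : ℝ))⁻¹), ← mul_assoc, show (2 * 3 : ℕ) = 3 + 3 from rfl,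
      inv_mul_cancel₀ (pow_ne_zero _ hLne), one_mul]
  have e3 : ((3 : ℕ) : ℝ) = (3 : ℝ) := by norm_num
  rw [e1, e2, e3] at h
  exact h

/-- [folklore] `BiLoc` is monotone in its constant. -/
theorem biLoc_mono {K : MKer (d + 1) (Fib d)} {p q : Fin (d + 1) → ℤ} {C C' δ' : ℝ} (h : BiLoc K p q C δ') (hCC' : C ≤ C') : BiLoc K p q C' δ' :=
  fun x z a b => (h x z a b).trans (mul_le_mul_of_nonneg_right hCC' (Real.exp_pos _).le)

/-- NOT IN PRINT; OUR BOOKKEEPING.  **(LT-3) AT `d = 3`, ONE WEIGHT, ONE RATIO** (the `hσ` shape of `WardRemainderRows.wLocStencil_unitS_of_unrolled` literally: `C·θ^k·ω κ u` with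
`θ^k = (√L)⁻¹`, `L = Lc^k`): taking the label centre `Y := y` (the block label of the face weight), since `η = min(κ∕2, δ∕2) ≤ κ∕2` and `L⁻¹ ≤ (√L)⁻¹` at `L ≥ 1`,
`BiLoc (L^{12} • push₃ l r w S ν U) U U ((K_E + 4³·K_G·CT)·(√L)⁻¹·e^{−η‖y−U‖₁}) (κ∕4)`. -/
theorem biLoc_cubic_push₃_layer_three_weight {l r w : Fin (3 + 1) → (Fin (3 + 1) → ℤ) → Fin (3 + 1) → (Fin (3 + 1) → ℤ) → ℝ}
    {S : Fin (3 + 1) → (Fin (3 + 1) → ℤ) → MKer (3 + 1) (Fib 3)} {ω : (Fin (3 + 1) → ℤ) → ℝ}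
    {Z : Fin (3 + 1) → Fin (3 + 1) → Fin (3 + 1) → (Fin (3 + 1) → ℤ) → (Fin (3 + 1) → ℤ) → ℝ} {T : Finset (Fin (3 + 1) → ℤ)}
    {L : ℕ} {A A' A'' Cs κ m δ B δZ ρ CT : ℝ}
    (hL : 1 ≤ L) (hκ : 0 < κ) (hm : κ < m) (hδ : 0 < δ) (hA : 0 ≤ A) (hA' : 0 ≤ A') (hA'' : 0 ≤ A'') (hCs : 0 ≤ Cs)
    (hB : 0 ≤ B) (hκδZ : 4 * κ < δZ)
    (hl : ∀ α x' k x, |l α x' k x| ≤ A * (((L : ℝ)) ^ (3 + 2))⁻¹ * Real.exp (-κ * l1 (quo L x - x')))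
    (hl' : ∀ α x' k x i, |l α x' k (x + Pi.single i 1) - l α x' k x| ≤ A' * (((L : ℝ)) ^ (3 + 3))⁻¹ * Real.exp (-κ * l1 (quo L x - x')))
    (hl'' : ∀ α x' k x i j, |(l α x' k (x + Pi.single i 1 + Pi.single j 1) - l α x' k (x + Pi.single j 1)) - (l α x' k (x + Pi.single i 1) - l α x' k x)|
      ≤ A'' * (((L : ℝ)) ^ (3 + 3) * Real.sqrt (L : ℝ))⁻¹ * Real.exp (-κ * l1 (quo L x - x')))
    (hr : ∀ β z' k z, |r β z' k z| ≤ A * (((L : ℝ)) ^ (3 + 2))⁻¹ * Real.exp (-κ * l1 (quo L z - z')))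
    (hr' : ∀ β z' k z i, |r β z' k (z + Pi.single i 1) - r β z' k z| ≤ A' * (((L : ℝ)) ^ (3 + 3))⁻¹ * Real.exp (-κ * l1 (quo L z - z')))
    (hr'' : ∀ β z' k z i j, |(r β z' k (z + Pi.single i 1 + Pi.single j 1) - r β z' k (z + Pi.single j 1)) - (r β z' k (z + Pi.single i 1) - r β z' k z)|
      ≤ A'' * (((L : ℝ)) ^ (3 + 3) * Real.sqrt (L : ℝ))⁻¹ * Real.exp (-κ * l1 (quo L z - z')))
    (hw : ∀ ν U k u, |w ν U k u| ≤ A * (((L : ℝ)) ^ (3 + 2))⁻¹ * Real.exp (-κ * l1 (quo L u - U)))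
    (hw' : ∀ ν U k u i, |w ν U k (u + Pi.single i 1) - w ν U k u| ≤ A' * (((L : ℝ)) ^ (3 + 3))⁻¹ * Real.exp (-κ * l1 (quo L u - U)))
    (hw'' : ∀ ν U k u i j, |(w ν U k (u + Pi.single i 1 + Pi.single j 1) - w ν U k (u + Pi.single j 1)) - (w ν U k (u + Pi.single i 1) - w ν U k u)|
      ≤ A'' * (((L : ℝ)) ^ (3 + 3) * Real.sqrt (L : ℝ))⁻¹ * Real.exp (-κ * l1 (quo L u - U)))
    (hS : ∀ k u x z a b, |S k u x z a b| ≤ Cs * ω u * Real.exp (-m * (l1 (x - u) + l1 (z - u))))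
    (y : Fin (3 + 1) → ℤ)
    (hω : ∀ u, 0 ≤ ω u ∧ ω u ≤ ∑ μ : Fin (3 + 1),
      (∑ v ∈ ((box (3 + 1) L).filter (fun v => v μ = L - 1)).image (fun v => (L : ℤ) • y + toSite v), Real.exp (-δ * l1 (v - u))
        + ∑ v ∈ ((box (3 + 1) L).filter (fun v => v μ = 0)).image (fun v => (L : ℤ) • y + toSite v - unitVec μ),
            Real.exp (-δ * l1 (v - u))))
    (hQ : ∀ k κ₁ κ₂ u, ∑' x, ∑' z, S k u x z (Sum.inl κ₁) (Sum.inl κ₂) = ∑ y' ∈ T, Z k κ₁ κ₂ y' u)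
    (hZ : ∀ k κ₁ κ₂, ∀ y' ∈ T, ∀ e, |Z k κ₁ κ₂ y' e| ≤ B * Real.exp (-δZ * l1 (e - y')))
    (hM0 : ∀ k κ₁ κ₂, ∀ y' ∈ T, ∑' e, Z k κ₁ κ₂ y' e = 0)
    (hP1 : ∀ k κ₁ κ₂, ∀ y' ∈ T, ∀ i : Fin (3 + 1), ∑' e, (((e - y') i : ℤ) : ℝ) * Z k κ₁ κ₂ y' e = 0)
    (hT : ∀ y' ∈ T, l1 (quo L y' - y) ≤ ρ) (hTcard : (T.card : ℝ) ≤ CT * (L : ℝ) ^ (3 + 1))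
    (ν : Fin (3 + 1)) (U : Fin (3 + 1) → ℤ) :
    BiLoc (((L : ℝ) ^ (3 * (3 + 1))) • push₃ l r w S ν U) U U
      ((((((3 : ℝ) + 1) ^ 3 * A ^ 2 * A' * Cs * (2 / (m - κ) * Zl (3 + 1) ((m - κ) / 2)) * (Zl (3 + 1) (m - κ) + Zl (3 + 1) m))
            * ((2 * ((3 : ℝ) + 1)) ^ 2 * Zl (3 + 1) (δ / 2) * Real.exp (min (κ / 2) (δ / 2))))
        + ((3 : ℝ) + 1) ^ 3 *
          ((((A'' * A * A + 2 * A' * A' * A + A * A'' * A) * Real.exp (2 * κ) + 2 * ((A' * A + A * A') * Real.exp κ) * A' + A * A * A'')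
              * Real.exp (2 * (2 * κ))) * B * (8 / (δZ - 2 * (2 * κ)) ^ 2 * Zl (3 + 1) ((δZ - 2 * (2 * κ)) / 4)) * Real.exp ((κ / 2) * ρ) * CT))
        * (Real.sqrt (L : ℝ))⁻¹ * Real.exp (-(min (κ / 2) (δ / 2)) * l1 (y - U)))
      (κ / 4) := by
  have hL0 : (0 : ℝ) < (L : ℝ) := by exact_mod_cast hL
  have hL1 : (1 : ℝ) ≤ (L : ℝ) := by exact_mod_cast hL
  have hmk : 0 < m - κ := sub_pos.2 hm
  have hc : 0 < δZ - 2 * (2 * κ) := by linarith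
  have hZ1 : 0 ≤ Zl (3 + 1) ((m - κ) / 2) := Zl_nonneg (half_pos hmk)
  have hZ2 : 0 ≤ Zl (3 + 1) (m - κ) := Zl_nonneg hmk
  have hZ3 : 0 ≤ Zl (3 + 1) m := Zl_nonneg (hκ.trans hm)
  have hZ4 : 0 ≤ Zl (3 + 1) (δ / 2) := Zl_nonneg (half_pos hδ)
  have hZ5 : 0 ≤ Zl (3 + 1) ((δZ - 2 * (2 * κ)) / 4) := Zl_nonneg (by positivity)
  have hCT : 0 ≤ CT := by
    have h0 : (0 : ℝ) ≤ (T.card : ℝ) := by positivity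
    by_contra hneg
    have h1 : CT * (L : ℝ) ^ (3 + 1) < 0 := mul_neg_of_neg_of_pos (not_le.1 hneg) (pow_pos hL0 _)
    linarith [hTcard]
  have h := biLoc_cubic_push₃_layer_ledger_three_half hL hκ hm hδ hA hA' hA'' hCs hB hκδZ hl hl' hl'' hr hr' hr'' hw hw' hw'' hS y hω hQ hZ hM0 hP1
    hT hTcard ν U
  refine biLoc_mono h ?_
  set KE : ℝ := (((3 : ℝ) + 1) ^ 3 * A ^ 2 * A' * Cs * (2 / (m - κ) * Zl (3 + 1) ((m - κ) / 2)) * (Zl (3 + 1) (m - κ) + Zl (3 + 1) m))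
            * ((2 * ((3 : ℝ) + 1)) ^ 2 * Zl (3 + 1) (δ / 2) * Real.exp (min (κ / 2) (δ / 2))) with hKE
  set KG : ℝ := ((3 : ℝ) + 1) ^ 3 *
          ((((A'' * A * A + 2 * A' * A' * A + A * A'' * A) * Real.exp (2 * κ) + 2 * ((A' * A + A * A') * Real.exp κ) * A' + A * A * A'')
              * Real.exp (2 * (2 * κ))) * B * (8 / (δZ - 2 * (2 * κ)) ^ 2 * Zl (3 + 1) ((δZ - 2 * (2 * κ)) / 4)) * Real.exp ((κ / 2) * ρ) * CT) with hKG
  have hKE0 : 0 ≤ KE := by rw [hKE]; positivity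
  have hKG0 : 0 ≤ KG := by rw [hKG]; positivity
  -- `L⁻¹ ≤ (√L)⁻¹` and `e^{−(κ/2)t} ≤ e^{−ηt}`
  have hs0 : 0 < Real.sqrt (L : ℝ) := Real.sqrt_pos.2 hL0
  have hsL : Real.sqrt (L : ℝ) ≤ (L : ℝ) := by
    have h1 : Real.sqrt (L : ℝ) * 1 ≤ Real.sqrt (L : ℝ) * Real.sqrt (L : ℝ) :=
      mul_le_mul_of_nonneg_left (by rw [show (1:ℝ) = Real.sqrt 1 from Real.sqrt_one.symm]; exact Real.sqrt_le_sqrt hL1) (Real.sqrt_nonneg _)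
    rw [mul_one, Real.mul_self_sqrt hL0.le] at h1
    exact h1
  have hinv : ((L : ℝ))⁻¹ ≤ (Real.sqrt (L : ℝ))⁻¹ := by rw [inv_le_inv₀ hL0 hs0]; exact hsL
  have hexp : Real.exp (-(κ / 2) * l1 (y - U)) ≤ Real.exp (-(min (κ / 2) (δ / 2)) * l1 (y - U)) :=
    Real.exp_le_exp.2 (by nlinarith [min_le_left (κ / 2) (δ / 2), l1_nonneg (y - U)])
  have h1 : KE * ((L : ℝ))⁻¹ * Real.exp (-(min (κ / 2) (δ / 2)) * l1 (y - U)) ≤ KE * (Real.sqrt (L : ℝ))⁻¹ * Real.exp (-(min (κ / 2) (δ / 2)) * l1 (y - U)) :=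
    mul_le_mul_of_nonneg_right (mul_le_mul_of_nonneg_left hinv hKE0) (Real.exp_pos _).le
  have h2 : KG * ((Real.sqrt (L : ℝ))⁻¹ * Real.exp (-(κ / 2) * l1 (y - U))) ≤ KG * ((Real.sqrt (L : ℝ))⁻¹ * Real.exp (-(min (κ / 2) (δ / 2)) * l1 (y - U))) :=
    mul_le_mul_of_nonneg_left (mul_le_mul_of_nonneg_left hexp (by positivity)) hKG0
  have e : KG * ((Real.sqrt (L : ℝ))⁻¹ * Real.exp (-(κ / 2) * l1 (y - U)))
      = ((3 : ℝ) + 1) ^ 3 *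
          (((((A'' * A * A + 2 * A' * A' * A + A * A'' * A) * Real.exp (2 * κ) + 2 * ((A' * A + A * A') * Real.exp κ) * A' + A * A * A'')
              * Real.exp (2 * (2 * κ))) * B * (8 / (δZ - 2 * (2 * κ)) ^ 2 * Zl (3 + 1) ((δZ - 2 * (2 * κ)) / 4)) * Real.exp ((κ / 2) * ρ) * CT)
            * (Real.sqrt (L : ℝ))⁻¹ * Real.exp (-(κ / 2) * l1 (y - U))) := by rw [hKG]; ring
  rw [← e]
  calc KE * ((L : ℝ))⁻¹ * Real.exp (-(min (κ / 2) (δ / 2)) * l1 (y - U)) + KG * ((Real.sqrt (L : ℝ))⁻¹ * Real.exp (-(κ / 2) * l1 (y - U)))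
      ≤ KE * (Real.sqrt (L : ℝ))⁻¹ * Real.exp (-(min (κ / 2) (δ / 2)) * l1 (y - U)) + KG * ((Real.sqrt (L : ℝ))⁻¹ * Real.exp (-(min (κ / 2) (δ / 2)) * l1 (y - U))) :=
        add_le_add h1 h2
    _ = (KE + KG) * (Real.sqrt (L : ℝ))⁻¹ * Real.exp (-(min (κ / 2) (δ / 2)) * l1 (y - U)) := by ring

end End

end Summit.QuantumFields.BalabanUV.Beta.GAN24.LayerTransportBiLoc

end
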